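import Summits.QuantumFields.BalabanUV.Beta.WardLocusSecondOrderLaw
import Summits.QuantumFields.BalabanUV.Beta.KernelWardCoarseExchange
import Summits.QuantumFields.BalabanUV.Beta.KernelWardMColumn
import Summits.QuantumFields.BalabanUV.Beta.KernelWardHColumnWall

/-!
# `BalabanUV.Beta.KernelWardMixedLaw` — binder row D1, hW W-side (W-L4), piece P2: THE MIXED BI-VERTEX UNDER THE TABLE-LEVEL
# FIRST-SLOT WARD LAW OF THE MIXED TABLE, and THE FIRST-ORDER HALF OF `hWd` ASSEMBLED — `divW (W2OfK …)` REDUCED TO ITS RESPONSE PIECE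

HONEST FRAMING (cell charter, verbatim): «discharging `BetaPertH` makes Bałaban's UV stability UNCONDITIONAL — a real constructive-QFT
result; it is NOT the continuum limit and NOT the Clay problem.»  DERIVED cell module (pub-balaban β sub-cell, lineage an1 «direct one-loop in
Bałaban's gauge», gen 27 — the hW root author's W-side bookkeeping lane, journal l.8696/l.8816/l.9007; planning document
`HOME/b2b-balaban-beta-an1-g27/SKELETON-D1-L4-HW.v1.md` §2).  [folklore] kernel algebra over an2's `SecondOrderResponse` carrier
(`vertexOfM`, `mixOfK`, `dM`, `K2OfK`, `W2OfK`), an1's coarse exchange calculus (`KernelWardCoarseExchange`), leaf-10's (B1)/(B2) block forms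
and P1 law (`WardLocusSecondOrder`, `WardLocusSecondOrderLaw`), an1's multiplier-row law (`KernelWardMColumn`) and leaf-07's ℋ-column law of
the wall family (`KernelWardHColumnWall`), all BY NAME; 0 def, no statement of Bałaban's papers typed, no `[cite:]` tag; the table-level
laws (T2-S₂), (T2-M₂) are HYPOTHESES (sockets) — nothing of (W-L4) is discharged.  NOT `BetaPertH`, NOT continuum, NOT Clay.
HONEST DEPENDENCY (cell records, verbatim): «continuum YM on T⁴ ⇐ BetaPertH ∧ nine spine estimates (0/9 proved); BetaPertH ⇐ (D1) ∧ (D4) ∧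
CAP+tail; G-an2-4 gates asym, D1 and NE2/3/4.»
ABSOLUTE RULE (cell charter, verbatim): «No internally-minted statement may enter as a cited fact. Every hypothesis is either kernel-proved in
this package or a verbatim quotation of a PUBLISHED theorem with page reference. The manuscript(s) under audit are NOT citable for their own
disputed steps — they are the thing under adjudication; programme-internal (2001/route/tribunal) claims are never citable.»

WHAT IS HERE.  The hW W-side socket of the recursive wall literal reads `divW (W j) y ν y′ = conjW 𝕄 0 V′ (X y) 0 X₂ + Nr` with
`conjW 𝕄 0 V′ X 0 X₂ = conjV V′ X + conjV 𝕄 X₂`.  For a `W` typed with an2's explicit-multiplier carrier,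
`W2OfK K N S M S₂ M₂ μ y ν y′ = vertex2OfK … + mixOfK … μ y ν y′ + mixOfK … ν y′ μ y + dM (K2OfK K N S M ν y′) N S M μ y` (pieces P1–P4).
* §3 (P2) `divW_mixOfK_of_tableLaw`: IF the mixed table obeys the TABLE-LEVEL FIRST-SLOT WARD LAW (T2-M₂)
  `cH • Σ_{v ∈ box} divV (fun κ u ↦ M₂ κ u ρ w) (N•y + v) = M ρ w ∘ X y − X y ∘ M ρ w + RM y ρ w`, THEN
  `divW (mixOfK K N M₂) y ν y′ = vertexOfM K N M ν y′ ∘ X y − X y ∘ vertexOfM K N M ν y′ + vertexOfM K N (RM y) ν y′` — the twin of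
  leaf-10's `divW_vertex2OfK_of_tableLaw` (P1), via leaf-10's (B2) block form `divW_mixOfK` and §2 of `KernelWardCoarseExchange`.
* §4 `divW_W2OfK_of_tableLaws`: P1 + P2 + P3 assembled (P3 ≡ 0 by the multiplier-row law (hMw), an1 `divW_mixOfK_swap_eq_zero`):
  `divW (W2OfK K N S M S₂ M₂) y ν y′ = conjV (dM K N S M ν y′) (X y) + dM K N (R y) (RM y) ν y′ + divW (response piece) y ν y′` —
  i.e. under (hH), (hMw), (T2-S₂), (T2-M₂) the socket `hWd` for such a `W` is EXACTLY the statement that the response piece P4 equals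
  `conjV 𝕄 X₂ − dM K N (R y) (RM y) ν y′ +` a local tadpole-null remainder (the (P4-closing identity) of the skeleton — NOT here), once
  `dM K N S M ν y′` is identified with the socket's folded `V′` (the order-one consistency lemma (c1) — NOT here).
* §5 the wall instances over `G_j = coDressKBmAt (toSite r) Lc (KInvStep Lc j)`, every `j`, every in-block root: (hH) and (hMw) discharged
  BY NAME (leaf-07 `colH_ward_KInvStep_all`, an1 `colM_coDressKBmAt_KInvStep_ward`), `cH = (stepScale d Lc j · Lc^{d+1})⁻¹`.
-/

noncomputable section

open Finset
open scoped BigOperators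
open Literature.MathematicalPhysics.QuantumFieldTheory
open Literature.MathematicalPhysics.QuantumFieldTheory.Balaban1983to89
open Literature.MathematicalPhysics.QuantumFieldTheory.Balaban1983to89.Beta
open B6BondElimination (unitVec)
open ExpKernelCalculus (MKer Decays comp Zl)
open KernelWard (divV divW)
open AffineAveraging (box toSite)
open OneStepResolventKernel (Fib LocStencil)
open OneStepKernelFamily (KInvStep colH vertexOfK)
open SecondOrderResponse (colM vertexOfM vertex2OfK mixOfK dM K2OfK W2OfK)
open Summit.QuantumFields.BalabanUV.Beta.TameKernelCalculus
open Summit.QuantumFields.BalabanUV.Beta.ChartConjugation (conjV)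
open Summit.QuantumFields.BalabanUV.Beta.ChartConjugationReflection (abs_le_of_locStencil)
open Summit.QuantumFields.BalabanUV.Beta.KernelWardRelative (gaugeWt)
open Summit.QuantumFields.BalabanUV.Beta.WardLocusSecondOrder (divW_mixOfK abs_vertexOfK_le abs_vertexOfM_le)
open Summit.QuantumFields.BalabanUV.Beta.WardLocusSecondOrderLaw (divW_vertex2OfK_of_tableLaw)
open Summit.QuantumFields.BalabanUV.Beta.KernelWardCoarseExchange (abs_comp_le_of_spr_left abs_comp_le_of_spr_right comp_add_of_bdd
  add_comp_of_bdd smul_vertexOfM vertexOfM_congr vertexOfM_add vertexOfM_neg vertexOfM_conjV sum_divV_vertexOfM_eq)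
open Summit.QuantumFields.BalabanUV.Beta.AxialDressingRooted (coDressKBmAt decays_coDressKBmAt_KInvStep)
open Summit.QuantumFields.BalabanUV.Beta.BorderedHessian (stepScale)
open Summit.QuantumFields.BalabanUV.Beta.KernelWardMColumn (colM_coDressKBmAt_KInvStep_ward)
open Summit.QuantumFields.BalabanUV.Beta.KernelWardHColumnWall (colH_ward_KInvStep_all)

namespace Summit.QuantumFields.BalabanUV.Beta.KernelWardMixedLaw

variable {d N : ℕ}

/-! ## §3 (P2) The mixed bi-vertex under the table-level first-slot Ward law of the mixed table -/

section TableLaw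

variable [NeZero N]

/-- [folklore] **THE MIXED BI-VERTEX PIECE OF THE SECOND-ORDER WARD SOCKET UNDER THE TABLE LAW (T2-M₂)**.  Data: decaying `K` (blocking
`N ≥ 1`) with the ℋ-column law (hH), a uniformly bounded multiplier-row table `M`, a mixed table `M₂` with a uniform entry bound, spread block
rotation generators `X y`, a bounded remainder table family `RM y`.  IF for every coarse site `y` and multiplier index `(ρ, w)`,
`cH • Σ_{v ∈ box} divV (fun κ u ↦ M₂ κ u ρ w) (N•y + v) = M ρ w ∘ X y − X y ∘ M ρ w + RM y ρ w`, THEN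
`divW (mixOfK K N M₂) y ν y′ = vertexOfM K N M ν y′ ∘ X y − X y ∘ vertexOfM K N M ν y′ + vertexOfM K N (RM y) ν y′`. -/
theorem divW_mixOfK_of_tableLaw {K : MKer (d + 1) (Fib d)} (hK : ∃ δ C : ℝ, 0 < δ ∧ 0 ≤ C ∧ Decays K C δ)
    {M : Fin (d + 1) → (Fin (d + 1) → ℤ) → MKer (d + 1) (Fib d)} {CM : ℝ} (hM : ∀ ρ w x z a b, |M ρ w x z a b| ≤ CM)
    {M₂ : Fin (d + 1) → (Fin (d + 1) → ℤ) → Fin (d + 1) → (Fin (d + 1) → ℤ) → MKer (d + 1) (Fib d)} {B₂ : ℝ}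
    (hB₂ : ∀ κ u ρ w x z a b, |M₂ κ u ρ w x z a b| ≤ B₂) (cH : ℝ)
    (hH : ∀ (y : Fin (d + 1) → ℤ) (κ' : Fin (d + 1)) (u : Fin (d + 1) → ℤ),
      ∑ μ, (colH K N μ (y - unitVec μ) κ' u - colH K N μ y κ' u) = cH * gaugeWt N y κ' u)
    {X : (Fin (d + 1) → ℤ) → MKer (d + 1) (Fib d)} (hX : ∀ y, Spr (X y))
    {RM : (Fin (d + 1) → ℤ) → Fin (d + 1) → (Fin (d + 1) → ℤ) → MKer (d + 1) (Fib d)} {BR : ℝ}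
    (hR : ∀ y ρ w x z a b, |RM y ρ w x z a b| ≤ BR)
    (hM₂ : ∀ (y : Fin (d + 1) → ℤ) (ρ : Fin (d + 1)) (w : Fin (d + 1) → ℤ),
      cH • ∑ v ∈ box (d + 1) N, divV (fun κ u => M₂ κ u ρ w) ((N : ℤ) • y + toSite v) =
        comp (M ρ w) (X y) - comp (X y) (M ρ w) + RM y ρ w)
    (y : Fin (d + 1) → ℤ) (ν : Fin (d + 1)) (y' : Fin (d + 1) → ℤ) :
    divW (mixOfK K N M₂) y ν y' =
      comp (vertexOfM K N M ν y') (X y) - comp (X y) (vertexOfM K N M ν y') + vertexOfM K N (RM y) ν y' := by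
  -- (B2): the slice is `cH •` the block contraction of the field slot, dressed in the multiplier slot; pull the block sum and the scalar inside
  rw [divW_mixOfK hK hB₂ cH hH y ν y', sum_divV_vertexOfM_eq hK hB₂ y ν y', smul_vertexOfM]
  -- the table law, multiplier index by multiplier index; the commutator form `M∘X − X∘M = −conjV X M`
  have hlaw : ∀ ρ w, cH • ∑ v ∈ box (d + 1) N, divV (fun κ u => M₂ κ u ρ w) ((N : ℤ) • y + toSite v) =
      -conjV (X y) (M ρ w) + RM y ρ w := fun ρ w => by
    rw [hM₂ y ρ w]
    unfold ChartConjugation.conjV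
    abel
  rw [vertexOfM_congr K hlaw ν y']
  -- bounds for the additivity of the multiplier-column vertex
  obtain ⟨CX, δX, hδX, hXd⟩ := hX y
  set BX : ℝ := (Fintype.card (Fib d) : ℝ) * CX * Zl (d + 1) δX * CM with hBX
  have hconj : ∀ ρ w x z a b, |(-conjV (X y) (M ρ w)) x z a b| ≤ BX + BX := by
    intro ρ w x z a b
    simp only [Pi.neg_apply, ChartConjugation.conjV, Pi.sub_apply, abs_neg]
    exact (abs_sub _ _).trans (add_le_add (abs_comp_le_of_spr_left hXd hδX (hM ρ w) x z a b)
      (abs_comp_le_of_spr_right hXd hδX (hM ρ w) x z a b))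
  rw [vertexOfM_add hK hconj (hR y) ν y', vertexOfM_neg, vertexOfM_conjV hK (hX y) hM ν y']
  unfold ChartConjugation.conjV
  abel

/-! ## §4 P1 + P2 + P3 assembled: `divW (W2OfK …)` is the `conjW₁` half of the socket, the remainder vertices, and the response piece -/

/-- [folklore] **THE FIRST-ORDER HALF OF THE SECOND-ORDER WARD SOCKET, ASSEMBLED.**  Under the ℋ-column law (hH) and the multiplier-column
law (hMw) of a decaying `K`, a LOCAL first-order field table `S`, a bounded multiplier-row table `M`, bounded second-order tables `S₂`, `M₂`
obeying the table-level first-slot Ward laws (T2-S₂) and (T2-M₂) against spread block generators `X y` with bounded remainder tables `R`,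
`RM`:  `divW (W2OfK K N S M S₂ M₂) y ν y′ = conjV (dM K N S M ν y′) (X y) + dM K N (R y) (RM y) ν y′
 + divW (fun μ y ν y′ ↦ dM (K2OfK K N S M ν y′) N S M μ y) y ν y′` — P1 (leaf-10 `divW_vertex2OfK_of_tableLaw`) + P2 (§3) + P3 ≡ 0 (an1
`divW_mixOfK_swap_eq_zero`); the last summand is the RESPONSE PIECE P4, untouched. -/
theorem divW_W2OfK_of_tableLaws {K : MKer (d + 1) (Fib d)} (hK : ∃ δ C : ℝ, 0 < δ ∧ 0 ≤ C ∧ Decays K C δ)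
    {S : Fin (d + 1) → (Fin (d + 1) → ℤ) → MKer (d + 1) (Fib d)} {Cs δs : ℝ} (hS : LocStencil S Cs δs) (hδs : 0 < δs)
    {M : Fin (d + 1) → (Fin (d + 1) → ℤ) → MKer (d + 1) (Fib d)} {CM : ℝ} (hM : ∀ ρ w x z a b, |M ρ w x z a b| ≤ CM)
    {S₂ : Fin (d + 1) → (Fin (d + 1) → ℤ) → Fin (d + 1) → (Fin (d + 1) → ℤ) → MKer (d + 1) (Fib d)} {B₂ : ℝ}
    (hB₂ : ∀ κ u κ' u' x z a b, |S₂ κ u κ' u' x z a b| ≤ B₂)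
    {M₂ : Fin (d + 1) → (Fin (d + 1) → ℤ) → Fin (d + 1) → (Fin (d + 1) → ℤ) → MKer (d + 1) (Fib d)} {B₂' : ℝ}
    (hB₂' : ∀ κ u ρ w x z a b, |M₂ κ u ρ w x z a b| ≤ B₂') (cH : ℝ)
    (hH : ∀ (y : Fin (d + 1) → ℤ) (κ' : Fin (d + 1)) (u : Fin (d + 1) → ℤ),
      ∑ μ, (colH K N μ (y - unitVec μ) κ' u - colH K N μ y κ' u) = cH * gaugeWt N y κ' u)
    (hMw : ∀ (y : Fin (d + 1) → ℤ) (ρ : Fin (d + 1)) (w : Fin (d + 1) → ℤ),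
      ∑ μ, (colM K N μ (y - unitVec μ) ρ w - colM K N μ y ρ w) = 0)
    {X : (Fin (d + 1) → ℤ) → MKer (d + 1) (Fib d)} (hX : ∀ y, Spr (X y))
    {R : (Fin (d + 1) → ℤ) → Fin (d + 1) → (Fin (d + 1) → ℤ) → MKer (d + 1) (Fib d)} {BR : ℝ}
    (hR : ∀ y κ u x z a b, |R y κ u x z a b| ≤ BR)
    {RM : (Fin (d + 1) → ℤ) → Fin (d + 1) → (Fin (d + 1) → ℤ) → MKer (d + 1) (Fib d)} {BR' : ℝ}
    (hRM : ∀ y ρ w x z a b, |RM y ρ w x z a b| ≤ BR')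
    (hS₂ : ∀ (y : Fin (d + 1) → ℤ) (κ' : Fin (d + 1)) (u' : Fin (d + 1) → ℤ),
      cH • ∑ v ∈ box (d + 1) N, divV (fun κ u => S₂ κ u κ' u') ((N : ℤ) • y + toSite v) =
        comp (S κ' u') (X y) - comp (X y) (S κ' u') + R y κ' u')
    (hM₂ : ∀ (y : Fin (d + 1) → ℤ) (ρ : Fin (d + 1)) (w : Fin (d + 1) → ℤ),
      cH • ∑ v ∈ box (d + 1) N, divV (fun κ u => M₂ κ u ρ w) ((N : ℤ) • y + toSite v) =
        comp (M ρ w) (X y) - comp (X y) (M ρ w) + RM y ρ w)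
    (y : Fin (d + 1) → ℤ) (ν : Fin (d + 1)) (y' : Fin (d + 1) → ℤ) :
    divW (W2OfK K N S M S₂ M₂) y ν y' =
      conjV (dM K N S M ν y') (X y) + dM K N (R y) (RM y) ν y'
        + divW (fun μ y ν y' => dM (K2OfK K N S M ν y') N S M μ y) y ν y' := by
  -- `divW` is additive over the four pieces of the carrier
  have eW : divW (W2OfK K N S M S₂ M₂) y ν y' =
      divW (vertex2OfK K N S₂) y ν y' + divW (mixOfK K N M₂) y ν y'
        + divW (fun μ y ν y' => mixOfK K N M₂ ν y' μ y) y ν y'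
        + divW (fun μ y ν y' => dM (K2OfK K N S M ν y') N S M μ y) y ν y' := by
    simp only [KernelWard.divW, ← Finset.sum_add_distrib]
    refine Finset.sum_congr rfl fun μ _ => ?_
    simp only [SecondOrderResponse.W2OfK]
    abel
  rw [eW, divW_vertex2OfK_of_tableLaw hK hS hδs hB₂ cH hH hX hR hS₂ y ν y',
    divW_mixOfK_of_tableLaw hK hM hB₂' cH hH hX hRM hM₂ y ν y',
    KernelWardMColumn.divW_mixOfK_swap_eq_zero hK hMw hB₂' y ν y', add_zero]
  -- the two first-order vertices are bounded, so `X y ∘ ·` and `· ∘ X y` distribute over `dM = vertexOfK + vertexOfM`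
  have hCs : ∀ κ u x z a b, |S κ u x z a b| ≤ Cs := abs_le_of_locStencil hS hδs.le
  have hVK : ∀ x z a b, |vertexOfK K N S ν y' x z a b| ≤ ∑ κ, (∑' u, |colH K N ν y' κ u|) * Cs :=
    fun x z a b => abs_vertexOfK_le hK hCs ν y' x z a b
  have hVM : ∀ x z a b, |vertexOfM K N M ν y' x z a b| ≤ ∑ ρ, (∑' w, |colM K N ν y' ρ w|) * CM :=
    fun x z a b => abs_vertexOfM_le hK hM ν y' x z a b
  have e1 : comp (X y) (dM K N S M ν y') = comp (X y) (vertexOfK K N S ν y') + comp (X y) (vertexOfM K N M ν y') := by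
    unfold SecondOrderResponse.dM; exact comp_add_of_bdd (hX y) hVK hVM
  have e2 : comp (dM K N S M ν y') (X y) = comp (vertexOfK K N S ν y') (X y) + comp (vertexOfM K N M ν y') (X y) := by
    unfold SecondOrderResponse.dM; exact add_comp_of_bdd (hX y) hVK hVM
  have e3 : dM K N (R y) (RM y) ν y' = vertexOfK K N (R y) ν y' + vertexOfM K N (RM y) ν y' := rfl
  unfold ChartConjugation.conjV
  rw [e1, e2, e3]
  abel

end TableLaw

/-! ## §5 The wall instances: `G_j = coDressKBmAt (toSite r) Lc (KInvStep Lc j)`, every `j`, every in-block root -/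

section Instances

variable {Lc : ℕ} [NeZero Lc] {r : Fin (d + 1) → ℕ}

/-- [folklore] **(P2) OVER THE WALL'S STEP PROPAGATOR**, every level, every in-block root: (hH) discharged by leaf-07's
`colH_ward_KInvStep_all` (`cH = (stepScale d Lc j · Lc^{d+1})⁻¹`). -/
theorem divW_mixOfK_coDressKBmAt_KInvStep_of_tableLaw (hr : r ∈ box (d + 1) Lc) (j : ℕ)
    {M : Fin (d + 1) → (Fin (d + 1) → ℤ) → MKer (d + 1) (Fib d)} {CM : ℝ} (hM : ∀ ρ w x z a b, |M ρ w x z a b| ≤ CM)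
    {M₂ : Fin (d + 1) → (Fin (d + 1) → ℤ) → Fin (d + 1) → (Fin (d + 1) → ℤ) → MKer (d + 1) (Fib d)} {B₂ : ℝ}
    (hB₂ : ∀ κ u ρ w x z a b, |M₂ κ u ρ w x z a b| ≤ B₂)
    {X : (Fin (d + 1) → ℤ) → MKer (d + 1) (Fib d)} (hX : ∀ y, Spr (X y))
    {RM : (Fin (d + 1) → ℤ) → Fin (d + 1) → (Fin (d + 1) → ℤ) → MKer (d + 1) (Fib d)} {BR : ℝ}
    (hR : ∀ y ρ w x z a b, |RM y ρ w x z a b| ≤ BR)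
    (hM₂ : ∀ (y : Fin (d + 1) → ℤ) (ρ : Fin (d + 1)) (w : Fin (d + 1) → ℤ),
      (stepScale d Lc j * (Lc : ℝ) ^ (d + 1))⁻¹ • ∑ v ∈ box (d + 1) Lc, divV (fun κ u => M₂ κ u ρ w) ((Lc : ℤ) • y + toSite v) =
        comp (M ρ w) (X y) - comp (X y) (M ρ w) + RM y ρ w)
    (y : Fin (d + 1) → ℤ) (ν : Fin (d + 1)) (y' : Fin (d + 1) → ℤ) :
    divW (mixOfK (coDressKBmAt (toSite r) Lc (KInvStep (d := d) Lc j)) Lc M₂) y ν y' =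
      comp (vertexOfM (coDressKBmAt (toSite r) Lc (KInvStep (d := d) Lc j)) Lc M ν y') (X y)
        - comp (X y) (vertexOfM (coDressKBmAt (toSite r) Lc (KInvStep (d := d) Lc j)) Lc M ν y')
        + vertexOfM (coDressKBmAt (toSite r) Lc (KInvStep (d := d) Lc j)) Lc (RM y) ν y' :=
  divW_mixOfK_of_tableLaw (decays_coDressKBmAt_KInvStep hr j) hM hB₂ _ (colH_ward_KInvStep_all hr j) hX hR hM₂ y ν y'

/-- [folklore] **THE FIRST-ORDER HALF OF `hWd` OVER THE WALL'S STEP PROPAGATOR, ASSEMBLED**, every level, every in-block root: (hH) by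
leaf-07's `colH_ward_KInvStep_all`, (hMw) by an1's `colM_coDressKBmAt_KInvStep_ward`; what remains of the socket is the response piece and
the order-one consistency of `dM G_j Lc S M` with the literal's folded table. -/
theorem divW_W2OfK_coDressKBmAt_KInvStep_of_tableLaws (hr : r ∈ box (d + 1) Lc) (j : ℕ)
    {S : Fin (d + 1) → (Fin (d + 1) → ℤ) → MKer (d + 1) (Fib d)} {Cs δs : ℝ} (hS : LocStencil S Cs δs) (hδs : 0 < δs)
    {M : Fin (d + 1) → (Fin (d + 1) → ℤ) → MKer (d + 1) (Fib d)} {CM : ℝ} (hM : ∀ ρ w x z a b, |M ρ w x z a b| ≤ CM)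
    {S₂ : Fin (d + 1) → (Fin (d + 1) → ℤ) → Fin (d + 1) → (Fin (d + 1) → ℤ) → MKer (d + 1) (Fib d)} {B₂ : ℝ}
    (hB₂ : ∀ κ u κ' u' x z a b, |S₂ κ u κ' u' x z a b| ≤ B₂)
    {M₂ : Fin (d + 1) → (Fin (d + 1) → ℤ) → Fin (d + 1) → (Fin (d + 1) → ℤ) → MKer (d + 1) (Fib d)} {B₂' : ℝ}
    (hB₂' : ∀ κ u ρ w x z a b, |M₂ κ u ρ w x z a b| ≤ B₂')
    {X : (Fin (d + 1) → ℤ) → MKer (d + 1) (Fib d)} (hX : ∀ y, Spr (X y))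
    {R : (Fin (d + 1) → ℤ) → Fin (d + 1) → (Fin (d + 1) → ℤ) → MKer (d + 1) (Fib d)} {BR : ℝ}
    (hR : ∀ y κ u x z a b, |R y κ u x z a b| ≤ BR)
    {RM : (Fin (d + 1) → ℤ) → Fin (d + 1) → (Fin (d + 1) → ℤ) → MKer (d + 1) (Fib d)} {BR' : ℝ}
    (hRM : ∀ y ρ w x z a b, |RM y ρ w x z a b| ≤ BR')
    (hS₂ : ∀ (y : Fin (d + 1) → ℤ) (κ' : Fin (d + 1)) (u' : Fin (d + 1) → ℤ),
      (stepScale d Lc j * (Lc : ℝ) ^ (d + 1))⁻¹ • ∑ v ∈ box (d + 1) Lc, divV (fun κ u => S₂ κ u κ' u') ((Lc : ℤ) • y + toSite v) =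
        comp (S κ' u') (X y) - comp (X y) (S κ' u') + R y κ' u')
    (hM₂ : ∀ (y : Fin (d + 1) → ℤ) (ρ : Fin (d + 1)) (w : Fin (d + 1) → ℤ),
      (stepScale d Lc j * (Lc : ℝ) ^ (d + 1))⁻¹ • ∑ v ∈ box (d + 1) Lc, divV (fun κ u => M₂ κ u ρ w) ((Lc : ℤ) • y + toSite v) =
        comp (M ρ w) (X y) - comp (X y) (M ρ w) + RM y ρ w)
    (y : Fin (d + 1) → ℤ) (ν : Fin (d + 1)) (y' : Fin (d + 1) → ℤ) :
    divW (W2OfK (coDressKBmAt (toSite r) Lc (KInvStep (d := d) Lc j)) Lc S M S₂ M₂) y ν y' =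
      conjV (dM (coDressKBmAt (toSite r) Lc (KInvStep (d := d) Lc j)) Lc S M ν y') (X y)
        + dM (coDressKBmAt (toSite r) Lc (KInvStep (d := d) Lc j)) Lc (R y) (RM y) ν y'
        + divW (fun μ y ν y' => dM (K2OfK (coDressKBmAt (toSite r) Lc (KInvStep (d := d) Lc j)) Lc S M ν y')
            Lc S M μ y) y ν y' :=
  divW_W2OfK_of_tableLaws (decays_coDressKBmAt_KInvStep hr j) hS hδs hM hB₂ hB₂' _ (colH_ward_KInvStep_all hr j)
    (colM_coDressKBmAt_KInvStep_ward (toSite r) j) hX hR hRM hS₂ hM₂ y ν y'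

end Instances

end Summit.QuantumFields.BalabanUV.Beta.KernelWardMixedLaw

end
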